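import Mathlib
import Literature.Computability.AlgebraicComplexity.NonscalarBilinearRank
import Literature.Computability.AlgebraicComplexity.SchoenhageTau
import HarnessLib

/-!
# Border rank is at most twice the border nonscalar complexity (Andrews 2022, Lemma 7)

Topic `Literature/Computability/AlgebraicComplexity`. Fourth support file for the formalisation of
Andrews 2022, Theorem 3 (`DeterminantalIdealComplexity.lean`). Andrews' Lemma 7 (cf. BCS 1997,
Prop. (14.1)): "Let `C̲_×(n)` denote the border multiplicative complexity of `n × n × n` matrix
multiplication. Then `C̲_×(n) ≤ R̲(⟨n,n,n⟩) ≤ 2 C̲_×(n)`." We prove the second inequality in the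
generality of an arbitrary 3-tensor `t` of bilinear coefficients and in the tree's currency of the
ALGEBRAIC border rank `algBorderRank` over `F[ε]` (Bläser 2013, Def. 6.1, file `SchoenhageTau`):
approximate computations are nonscalar computation sequences over the Laurent series field
`F((ε))` (which contains Andrews' `F(ε)`), and "`= t + O(ε)`" is coefficientwise vanishing of all
Laurent coefficients of negative index of the error together with the right constant term.

## Content

* `IsOrdGE k x` — the Laurent series `x ∈ F((ε))` is `O(ε^k)`: all its coefficients of index
  `< k` vanish; closure under sums, products (`IsOrdGE.mul`: orders add), `ε`-shifts; every Laurent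
  series is `O(ε^{-d})` for some `d ∈ ℕ`, uniformly on finite families.
* `algBorderRank_le_of_laurentSeries` — **clearing denominators**: if
  `Σ_{ρ<r} w_ρ(a) u_ρ(b) v_ρ(c) = t(a,b,c) + O(ε)` with vectors over `F((ε))`, then `bR(t) ≤ r`:
  multiply each vector by `ε^d` to make it a power series, truncate at degree `3d`, and read off an
  approximate decomposition of order `h = 3d` over `F[ε]` (Bläser 2013, Def. 6.1 / the remark that
  `F(ε)`- and `F[ε]`-border rank agree, BCS 1997, (15.20)–(15.21); Andrews 2022, §2.5).
* `algBorderRank_le_of_isNonscalarSeq_laurent` — **Lemma 7, border form of `R ≤ 2 L^{ns}`**: if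
  polynomials `p_o ∈ F((ε))[x, y, …]` with `coeff_{x_a y_b}(p_o) = t(o,a,b) + O(ε)` all lie in the
  cost-free span of one nonscalar computation sequence of length `≤ N` over `F((ε))`, then
  `bR(t) ≤ 2N` (with `NonscalarBilinearRank.exists_triads_of_isNonscalarSeq`).

## References

* [Andrews2022] R. Andrews, FOCS 2022, arXiv:2208.01078, §2.5 and Lemma 7.
* [BurgisserClausenShokrollahi1997] P. Bürgisser, M. Clausen, M. A. Shokrollahi, 1997,
  Prop. (14.1), §15.4 (15.20)–(15.21) (border rank over `F(ε)` vs `F[ε]`).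
* [Blaser2013] M. Bläser, Fast Matrix Multiplication, 2013, Def. 6.1.
-/

noncomputable section

open MvPolynomial

namespace Literature.Computability.AlgebraicComplexity

universe u v w w'

/-! ### `O(ε^k)` for Laurent series -/

section OrdGE

variable {F : Type u} [CommRing F]

/-- `IsOrdGE k x`: the Laurent series `x ∈ F((ε))` is `O(ε^k)`, i.e. every coefficient of index
`< k` vanishes (for `x ≠ 0`: its order is `≥ k`). This is the coefficientwise meaning of Andrews'
"`f + ε g` with `g ∈ F[ε][…]`" / "`+ O(ε)`" (Andrews 2022, Def. 4), inside `F((ε)) ⊇ F(ε)`.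
[cite: Andrews2022, Def. 4] -/
def IsOrdGE (k : ℤ) (x : LaurentSeries F) : Prop :=
  ∀ i : ℤ, i < k → x.coeff i = 0

namespace IsOrdGE

/-- `0 = O(ε^k)`. [folklore] -/
theorem zero (k : ℤ) : IsOrdGE k (0 : LaurentSeries F) := fun i _ => by simp

/-- Weakening the order. [folklore] -/
theorem mono {k l : ℤ} (h : l ≤ k) {x : LaurentSeries F} (hx : IsOrdGE k x) : IsOrdGE l x :=
  fun i hi => hx i (lt_of_lt_of_le hi h)

/-- Sums. [folklore] -/
theorem add {k : ℤ} {x y : LaurentSeries F} (hx : IsOrdGE k x) (hy : IsOrdGE k y) :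
    IsOrdGE k (x + y) := fun i hi => by
  rw [HahnSeries.coeff_add, hx i hi, hy i hi, add_zero]

/-- Negation. [folklore] -/
theorem neg {k : ℤ} {x : LaurentSeries F} (hx : IsOrdGE k x) : IsOrdGE k (-x) := fun i hi => by
  rw [HahnSeries.coeff_neg, hx i hi, neg_zero]

/-- Differences. [folklore] -/
theorem sub {k : ℤ} {x y : LaurentSeries F} (hx : IsOrdGE k x) (hy : IsOrdGE k y) :
    IsOrdGE k (x - y) := fun i hi => by
  rw [HahnSeries.coeff_sub, hx i hi, hy i hi, sub_zero]

/-- Finite sums. [folklore] -/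
theorem sum {k : ℤ} {ι : Type w} {s : Finset ι} {f : ι → LaurentSeries F}
    (h : ∀ i ∈ s, IsOrdGE k (f i)) : IsOrdGE k (∑ i ∈ s, f i) := fun j hj => by
  rw [HahnSeries.coeff_sum]
  exact Finset.sum_eq_zero fun i hi => h i hi j hj

/-- Scalars. [folklore] -/
theorem smul {k : ℤ} {x : LaurentSeries F} (c : F) (hx : IsOrdGE k x) : IsOrdGE k (c • x) :=
  fun i hi => by rw [HahnSeries.coeff_smul, hx i hi, smul_zero]

/-- **Orders add under multiplication**: `O(ε^k) · O(ε^l) = O(ε^{k+l})`. [folklore] -/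
theorem mul {k l : ℤ} {x y : LaurentSeries F} (hx : IsOrdGE k x) (hy : IsOrdGE l y) :
    IsOrdGE (k + l) (x * y) := by
  intro i hi
  rw [HahnSeries.coeff_mul]
  refine Finset.sum_eq_zero fun p hp => ?_
  rw [Finset.mem_antidiagonal] at hp
  obtain ⟨-, -, hsum⟩ := hp
  by_cases h1 : p.1 < k
  · rw [hx _ h1, zero_mul]
  · have h2 : p.2 < l := by omega
    rw [hy _ h2, mul_zero]

/-- `c ε^n = O(ε^n)`. [folklore] -/
theorem single (n : ℤ) (c : F) : IsOrdGE n (HahnSeries.single n c) :=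
  fun _ hi => HahnSeries.coeff_single_of_ne (ne_of_lt hi)

/-- Constants are `O(1)`. [folklore] -/
theorem C (c : F) : IsOrdGE 0 (HahnSeries.C c : LaurentSeries F) := by
  rw [HahnSeries.C_apply]
  exact single 0 c

/-- `1 = O(1)`. [folklore] -/
theorem one : IsOrdGE 0 (1 : LaurentSeries F) := by
  rw [← HahnSeries.single_zero_one]
  exact single 0 1

/-- `ε`-shifts: `ε^n · O(ε^k) = O(ε^{n+k})`. [folklore] -/
theorem single_mul {k : ℤ} {x : LaurentSeries F} (hx : IsOrdGE k x) (n : ℤ) (c : F) :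
    IsOrdGE (n + k) (HahnSeries.single n c * x) :=
  (single n c).mul hx

/-- Power series are `O(1)`. [folklore] -/
theorem ofPowerSeries (φ : PowerSeries F) : IsOrdGE 0 (HahnSeries.ofPowerSeries ℤ F φ) :=
  fun i hi => by
    rw [PowerSeries.coeff_coe, if_pos hi]

/-- Every Laurent series is `O(ε^k)` for some `k`. [folklore] -/
theorem exists_of (x : LaurentSeries F) : ∃ k : ℤ, IsOrdGE k x := by
  by_cases hx : x = 0
  · subst hx
    exact ⟨0, zero 0⟩
  · exact ⟨x.order, fun i hi => HahnSeries.coeff_eq_zero_of_lt_order hi⟩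

/-- Every Laurent series is `O(ε^{-d})` for some natural number `d`. [folklore] -/
theorem exists_neg_nat (x : LaurentSeries F) : ∃ d : ℕ, IsOrdGE (-(d : ℤ)) x := by
  obtain ⟨k, hk⟩ := exists_of x
  refine ⟨(-k).toNat, hk.mono ?_⟩
  have := Int.self_le_toNat (-k)
  omega

/-- A finite family of Laurent series has a common bound `O(ε^{-d})`. [folklore] -/
theorem exists_neg_nat_forall {ι : Type w} [Fintype ι] (f : ι → LaurentSeries F) :
    ∃ d : ℕ, ∀ i, IsOrdGE (-(d : ℤ)) (f i) := by
  classical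
  choose d hd using fun i => exists_neg_nat (f i)
  refine ⟨∑ i, d i, fun i => (hd i).mono ?_⟩
  have : d i ≤ ∑ j, d j := Finset.single_le_sum (fun _ _ => Nat.zero_le _) (Finset.mem_univ i)
  omega

end IsOrdGE

/-- A Laurent series which is `O(1)` is the power series with the same coefficients. [folklore] -/
theorem ofPowerSeries_mk_coeff {x : LaurentSeries F} (hx : IsOrdGE 0 x) :
    HahnSeries.ofPowerSeries ℤ F (PowerSeries.mk fun n => x.coeff n) = x := by
  ext i
  rw [PowerSeries.coeff_coe]
  split_ifs with hi
  · exact (hx i hi).symm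
  · rw [PowerSeries.coeff_mk, Int.natAbs_of_nonneg (le_of_not_gt hi)]

/-- Low coefficients of a product of power series depend only on low coefficients of the
factors. [folklore] -/
theorem PowerSeries.coeff_mul_eq_of_coeff_eq_of_le {f f' g g' : PowerSeries F} {n : ℕ}
    (hf : ∀ i ≤ n, PowerSeries.coeff i f = PowerSeries.coeff i f')
    (hg : ∀ i ≤ n, PowerSeries.coeff i g = PowerSeries.coeff i g') :
    ∀ j ≤ n, PowerSeries.coeff j (f * g) = PowerSeries.coeff j (f' * g') := by
  intro j hj
  rw [PowerSeries.coeff_mul, PowerSeries.coeff_mul]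
  refine Finset.sum_congr rfl fun p hp => ?_
  rw [Finset.HasAntidiagonal.mem_antidiagonal] at hp
  rw [hf p.1 (by omega), hg p.2 (by omega)]

/-- The truncation `trunc (h+1) φ` has the same coefficients as `φ` up to degree `h`. [folklore] -/
theorem PowerSeries.coeff_coe_trunc_succ_of_le (φ : PowerSeries F) {h i : ℕ} (hi : i ≤ h) :
    PowerSeries.coeff i ((PowerSeries.trunc (h + 1) φ : Polynomial F) : PowerSeries F) =
      PowerSeries.coeff i φ := by
  rw [Polynomial.coeff_coe, PowerSeries.coeff_trunc, if_pos (Nat.lt_succ_of_le hi)]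

end OrdGE

/-! ### From `F((ε))`-decompositions to approximate decompositions over `F[ε]` -/

section Border

variable {F : Type u} [Field F]

/-- **Clearing denominators** (Bläser 2013, Def. 6.1; BCS 1997, (15.20)–(15.21); Andrews 2022,
§2.5): if `Σ_{ρ<r} w_ρ(a) u_ρ(b) v_ρ(c) = t(a,b,c) + O(ε)` with vectors over the Laurent series
field `F((ε))`, then `bR(t) ≤ r` for the algebraic border rank over `F[ε]`: multiply `w, u, v` by
`ε^d` so that they become power series, truncate at degree `3d`, and obtain
`Σ_ρ w̃_ρ ⊗ ũ_ρ ⊗ ṽ_ρ = ε^{3d} t + O(ε^{3d+1})` over `F[ε]`. [cite: Blaser2013, Def. 6.1] -/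
theorem algBorderRank_le_of_laurentSeries {ι : Type v} {κ : Type w} {μ : Type w'} [Fintype ι]
    [Fintype κ] [Fintype μ] (t : ι → κ → μ → F) {r : ℕ} (w : Fin r → ι → LaurentSeries F)
    (u : Fin r → κ → LaurentSeries F) (v : Fin r → μ → LaurentSeries F)
    (h : ∀ a b c, IsOrdGE 1 (∑ ρ, w ρ a * u ρ b * v ρ c - HahnSeries.C (t a b c))) :
    algBorderRank t ≤ r := by
  classical
  -- a common power `ε^d` clearing all the poles
  obtain ⟨d₁, hd₁⟩ := IsOrdGE.exists_neg_nat_forall fun p : Fin r × ι => w p.1 p.2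
  obtain ⟨d₂, hd₂⟩ := IsOrdGE.exists_neg_nat_forall fun p : Fin r × κ => u p.1 p.2
  obtain ⟨d₃, hd₃⟩ := IsOrdGE.exists_neg_nat_forall fun p : Fin r × μ => v p.1 p.2
  set d : ℕ := d₁ + d₂ + d₃ with hd
  set s : LaurentSeries F := HahnSeries.single (d : ℤ) 1 with hs
  have hw : ∀ ρ a, IsOrdGE 0 (s * w ρ a) := fun ρ a =>
    ((hd₁ (ρ, a)).single_mul (d : ℤ) 1).mono (by omega)
  have hu : ∀ ρ b, IsOrdGE 0 (s * u ρ b) := fun ρ b =>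
    ((hd₂ (ρ, b)).single_mul (d : ℤ) 1).mono (by omega)
  have hv : ∀ ρ c, IsOrdGE 0 (s * v ρ c) := fun ρ c =>
    ((hd₃ (ρ, c)).single_mul (d : ℤ) 1).mono (by omega)
  -- the corresponding power series and their truncations at degree `3d`
  set φw : Fin r → ι → PowerSeries F := fun ρ a => PowerSeries.mk fun n => (s * w ρ a).coeff n
  set φu : Fin r → κ → PowerSeries F := fun ρ b => PowerSeries.mk fun n => (s * u ρ b).coeff n
  set φv : Fin r → μ → PowerSeries F := fun ρ c => PowerSeries.mk fun n => (s * v ρ c).coeff n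
  have hφw : ∀ ρ a, HahnSeries.ofPowerSeries ℤ F (φw ρ a) = s * w ρ a := fun ρ a =>
    ofPowerSeries_mk_coeff (hw ρ a)
  have hφu : ∀ ρ b, HahnSeries.ofPowerSeries ℤ F (φu ρ b) = s * u ρ b := fun ρ b =>
    ofPowerSeries_mk_coeff (hu ρ b)
  have hφv : ∀ ρ c, HahnSeries.ofPowerSeries ℤ F (φv ρ c) = s * v ρ c := fun ρ c =>
    ofPowerSeries_mk_coeff (hv ρ c)
  set N : ℕ := 3 * d with hN
  set Pw : Fin r → ι → Polynomial F := fun ρ a => PowerSeries.trunc (N + 1) (φw ρ a)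
  set Pu : Fin r → κ → Polynomial F := fun ρ b => PowerSeries.trunc (N + 1) (φu ρ b)
  set Pv : Fin r → μ → Polynomial F := fun ρ c => PowerSeries.trunc (N + 1) (φv ρ c)
  have hsss : s * s * s = HahnSeries.single (N : ℤ) 1 := by
    rw [hs, HahnSeries.single_mul_single, HahnSeries.single_mul_single, mul_one, mul_one, hN]
    congr 1
    push_cast
    ring
  have happrox : IsApproxDecomposition N t Pw Pu Pv := by
    intro a b c j hj
    -- polynomial coefficients are power series coefficients up to degree `N`
    have h1 : (∑ ρ, Pw ρ a * Pu ρ b * Pv ρ c).coeff j =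
        PowerSeries.coeff j (∑ ρ, φw ρ a * φu ρ b * φv ρ c) := by
      rw [Polynomial.finsetSum_coeff, map_sum]
      refine Finset.sum_congr rfl fun ρ _ => ?_
      rw [← Polynomial.coeff_coe, Polynomial.coe_mul, Polynomial.coe_mul]
      exact PowerSeries.coeff_mul_eq_of_coeff_eq_of_le
        (PowerSeries.coeff_mul_eq_of_coeff_eq_of_le
          (fun i hi => PowerSeries.coeff_coe_trunc_succ_of_le _ hi)
          (fun i hi => PowerSeries.coeff_coe_trunc_succ_of_le _ hi))
        (fun i hi => PowerSeries.coeff_coe_trunc_succ_of_le _ hi) j hj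
    -- power series coefficients are Laurent coefficients
    have h2 : PowerSeries.coeff j (∑ ρ, φw ρ a * φu ρ b * φv ρ c) =
        (HahnSeries.single (N : ℤ) 1 * ∑ ρ, w ρ a * u ρ b * v ρ c).coeff (j : ℤ) := by
      rw [← LaurentSeries.coeff_coe_powerSeries, map_sum]
      simp only [map_mul, hφw, hφu, hφv]
      rw [Finset.mul_sum]
      congr 1
      refine Finset.sum_congr rfl fun ρ _ => ?_
      rw [← hsss]
      ring
    rw [h1, h2, HahnSeries.coeff_single_mul, one_mul]
    have hsplit : ∑ ρ, w ρ a * u ρ b * v ρ c =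
        HahnSeries.C (t a b c) + (∑ ρ, w ρ a * u ρ b * v ρ c - HahnSeries.C (t a b c)) := by
      ring
    have hC : ∀ m : ℤ, (HahnSeries.C (t a b c) : LaurentSeries F).coeff m =
        if m = 0 then t a b c else 0 := fun m => by
      rw [HahnSeries.C_apply, HahnSeries.coeff_single]
      split_ifs <;> rfl
    rw [hsplit, HahnSeries.coeff_add, hC]
    by_cases hjN : j = N
    · subst hjN
      rw [if_pos (by simp), if_pos rfl, sub_self, h a b c 0 zero_lt_one, add_zero]
    · have hlt : (j : ℤ) - N < 0 := by
        have : j < N := lt_of_le_of_ne hj hjN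
        omega
      rw [if_neg (ne_of_lt hlt), if_neg hjN, h a b c ((j : ℤ) - N) (by omega), add_zero]
  exact (algBorderRank_le_approxRank N t).trans (approxRank_le_of_isApproxDecomposition happrox)

/-- **Andrews 2022, Lemma 7 (border form of `R ≤ 2 · L^{ns}`, BCS 1997, Prop. (14.1)).** Let
`x : α → σ`, `y : β → σ` be disjoint families of variables and `p_o ∈ F((ε))[X_σ]` (`o ∈ ο`)
polynomials whose bilinear coefficients approximate a tensor `t`: `coeff_{x_a y_b}(p_o) =
t(o,a,b) + O(ε)`. If all `p_o` lie in the cost-free span of one nonscalar computation sequence of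
length `≤ N` over `F((ε))` (a border computation with `≤ N` nonscalar multiplications), then the
algebraic border rank of `t` over `F[ε]` is at most `2N`. [cite: Andrews2022, Lemma 7] -/
theorem algBorderRank_le_of_isNonscalarSeq_laurent {σ : Type v} [DecidableEq σ] {α : Type w}
    {β : Type w'} {ο : Type*} [Fintype α] [Fintype β] [Fintype ο] (x : α → σ) (y : β → σ)
    (hxy : ∀ a b, x a ≠ y b) {N : ℕ} (p : ο → MvPolynomial σ (LaurentSeries F))
    (t : ο → α → β → F)
    (h : ∃ gs : List (MvPolynomial σ (LaurentSeries F)), IsNonscalarSeq gs ∧ gs.length ≤ N ∧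
      ∀ o, p o ∈ freeSpan {q | q ∈ gs})
    (ht : ∀ o a b, IsOrdGE 1
      (coeff (Finsupp.single (x a) 1 + Finsupp.single (y b) 1) (p o) - HahnSeries.C (t o a b))) :
    algBorderRank t ≤ 2 * N := by
  obtain ⟨r, hr, w, u, v, hwuv⟩ := exists_triads_of_isNonscalarSeq x y hxy p h
  refine le_trans (algBorderRank_le_of_laurentSeries t w u v fun o a b => ?_) hr
  rw [hwuv]
  exact ht o a b

end Border

end Literature.Computability.AlgebraicComplexity
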